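import Summits.AtomisticToContinuum.FouriersLaw.Theorems.OddSectorIrreversibilitySubBallisticWindowAbelCorrector
import Summits.AtomisticToContinuum.FouriersLaw.Theorems.OddSectorIrreversibilitySubBallisticWindowPartial
import Mathlib.Analysis.SpecialFunctions.Gaussian.GaussianIntegral

/-!
# `SubBallisticWindow` (stmt-AtomisticToContinuum-14070): the Abel–Green–Kubo form of the crux, part 2

Support file for crux `Summit.AtomisticToContinuum.FouriersLaw.Theses.OddSectorIrreversibility.SubBallisticWindow`
(E2 of route OddSectorIrreversibility). With the Abel (resolvent) corrector
`u_r(x) = ∫_{(0,∞)} e^{-r t} J_B(Φ_t x) dt` of the CLOSED chain (part 1,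
`…SubBallisticWindowAbelCorrector.lean`: flow shift, `(r - L) u_r = J_B` along the flow, window identity, and the
ceiling `V_B(τ) ≤ 3 (r²τ² + 2) ‖u_r‖²_{L²(μ_T)}`), this part states the reduction in the crux's own vocabulary:

* `subBallisticWindow_of_abelBound` — if `r ‖u_r‖²_{L²(μ_T)} ≤ C (k₂ - k₁) Z` uniformly in `N`, the block and
  `r ∈ (0,1]`, then `SubBallisticWindow` (rate `r = 1/τ` for `τ ≥ 1`, `Partial.shortWindows` for `τ ≤ 1`);
* small facts used by the converse (part 3, `…AbelGreenKuboConverse.lean`): the moments `∫_{(0,∞)} e^{-rt} = 1/r`,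
  `∫_{(0,∞)} t e^{-rt} = 1/r²`, integrability of `tⁿ e^{-rt}`, and the window at nonpositive times.

Since `⟨J_B, u_r⟩_{μ_T} = ∫_{(0,∞)} e^{-rt} ⟨J_B∘Φ_t, J_B⟩_{μ_T} dt = r ‖u_r‖²` (on paper: skew-symmetry of the
Liouvillian on `L²(μ_T)`; this pairing identity is not formalised here), the hypothesis reads "the Abel-regularised finite-volume GREEN–KUBO integral of the block current is
bounded by `C ℓ Z`, uniformly in volume, block and cutoff" — bounded block conductivity, the textbook form of the open
problem (BonettoLebowitzReyBellet2000 §6.3). No spatial regularity of `u_r` is assumed (contrast the `C²` test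
observable of the Thomson stub `stub_correctorFamily`). Nothing here closes the item. Lead c8 of line `Sketch`, 2026-08-17.
-/

noncomputable section

namespace Summit.AtomisticToContinuum.FouriersLaw.Theorems.SubBallisticWindow.AbelGreenKubo

open MeasureTheory Filter Topology Set
open scoped NNReal ENNReal
open Literature.MathematicalPhysics.KineticTheory.HeatConduction
open Summit.AtomisticToContinuum.FouriersLaw.Theorems.ClosedConeSensitivity.Negative.ZeroFrictionDictionary
open Summit.AtomisticToContinuum.FouriersLaw.Theorems.OddSectorWitness

variable {ω₂ lam β : ℝ} (hω : 0 < ω₂) (hl : 0 ≤ lam) (hβ : 0 ≤ β)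
include hω hl hβ

/-! ## §2b One-dimensional facts used by the converse (part 3): moments of the exponential density -/

omit hω hl hβ in
/-- `t ↦ tⁿ e^{-rt}` is integrable on `(0, ∞)` (`r > 0`). [folklore] -/
theorem integrableOn_pow_mul_exp_neg_mul (n : ℕ) {r : ℝ} (hr : 0 < r) :
    IntegrableOn (fun t : ℝ => t ^ n * Real.exp (-r * t)) (Ioi 0) := by
  have hs : (-1 : ℝ) < n := by
    have : (0 : ℝ) ≤ n := n.cast_nonneg
    linarith
  have h := integrableOn_rpow_mul_exp_neg_mul_rpow (s := (n : ℝ)) (p := 1) hs le_rfl hr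
  refine h.congr_fun (fun t _ => ?_) measurableSet_Ioi
  simp only [Real.rpow_natCast, Real.rpow_one]

omit hω hl hβ in
/-- `∫_{(0,∞)} e^{-rt} dt = 1/r` (`r > 0`). [folklore] -/
theorem integral_exp_neg_mul_Ioi_eq {r : ℝ} (hr : 0 < r) :
    ∫ t in Ioi (0:ℝ), Real.exp (-r * t) = 1 / r := by
  rw [integral_exp_mul_Ioi (neg_neg_iff_pos.2 hr) 0]
  field_simp
  simp

omit hω hl hβ in
/-- `∫_{(0,∞)} t e^{-rt} dt = 1/r²` (`r > 0`; Euler's integral `Γ(2) = 1`). [folklore] -/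
theorem integral_mul_exp_neg_mul_Ioi_eq {r : ℝ} (hr : 0 < r) :
    ∫ t in Ioi (0:ℝ), t * Real.exp (-r * t) = 1 / r ^ 2 := by
  have h := Real.integral_rpow_mul_exp_neg_mul_Ioi (a := 2) (r := r) two_pos hr
  have h2 : Real.Gamma 2 = 1 := by
    rw [show (2:ℝ) = 1 + 1 by norm_num, Real.Gamma_add_one one_ne_zero, Real.Gamma_one, one_mul]
  have h' : ∫ t in Ioi (0:ℝ), t * Real.exp (-r * t) =
      ∫ t in Ioi (0:ℝ), t ^ ((2:ℝ) - 1) * Real.exp (-(r * t)) :=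
    setIntegral_congr_fun measurableSet_Ioi fun t _ => by
      rw [show (2:ℝ) - 1 = 1 by norm_num, Real.rpow_one, neg_mul]
  rw [h', h, h2, Real.rpow_two]
  field_simp

/-! ## §2c The window at all real times (used by part 3) -/

section Window

variable (γ : ℝ) (N k₁ k₂ : ℕ)

omit hω hl hβ in
/-- The window at nonpositive times vanishes. [folklore] -/
theorem window_of_nonpos (γ : ℝ) (N k₁ k₂ : ℕ) {t : ℝ} (ht : t ≤ 0) (x : PhaseSpace N) :
    window ω₂ lam β γ N k₁ k₂ t x = 0 := by
  unfold window
  rw [Ioc_eq_empty (not_lt.2 ht), Measure.restrict_empty, integral_zero_measure]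

/-- Uniform-in-sign energy bound for the window: `|Q_B(t)(x)| ≤ |t| K(x)`. [folklore] -/
theorem abs_window_le_abs (t : ℝ) (x : PhaseSpace N) :
    |window ω₂ lam β γ N k₁ k₂ t x| ≤
      |t| * (N * (N * ((3 + β) / 2 * (1 + (pinnedChain ω₂ lam β γ).hamiltonian N x) ^ 2))) := by
  rcases le_or_gt t 0 with ht | ht
  · rw [window_of_nonpos γ N k₁ k₂ ht x, abs_zero]
    have hH : 0 ≤ (pinnedChain ω₂ lam β γ).hamiltonian N x := pinnedChain_hamiltonian_nonneg hω.le hl hβ γ N x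
    positivity
  · rw [abs_of_pos ht]
    exact abs_window_le hω hl hβ N γ k₁ k₂ ht.le x

end Window

/-! ## §3 The Abel bound implies the crux (crux vocabulary) -/

section Crux

open Summit.AtomisticToContinuum.FouriersLaw.Theses.OddSectorIrreversibility

/-- Dirac dictionary for the Abel integral: for the closed chain the kernel average of the block current is its
value along the Hamiltonian flow, so `∫_{(0,∞)} e^{-rt} (P⁰_t J_B)(x) dt = u_r(x)`. [folklore] -/
theorem integral_abel_kernel_eq (γ : ℝ) (N k₁ k₂ : ℕ) (T r : ℝ) (x : PhaseSpace N) :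
    ∫ t in Ioi (0:ℝ), Real.exp (-r * t) * (∫ y, blockCurrent ω₂ lam β γ N k₁ k₂ y
        ∂((pinnedChain ω₂ lam β 0).transitionKernel N T T t.toNNReal x)) =
      ∫ t in Ioi (0:ℝ), Real.exp (-r * t) * blockCurrent ω₂ lam β γ N k₁ k₂ (detFlow ω₂ lam β N t x) := by
  refine setIntegral_congr_fun measurableSet_Ioi fun t ht => ?_
  rw [integral_transitionKernel_zero_friction hω hl hβ, Real.coe_toNNReal _ (le_of_lt ht)]

omit hω hl hβ in
/-- **The Abel (Green–Kubo resolvent) bound implies `SubBallisticWindow`.** Suppose that for all parameters `> 0`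
and `T > 0` there is `C` such that for every `N`, every block `[k₁,k₂)` (`k₂ + 1 ≤ N`) and every rate `r ∈ (0,1]`
the Abel corrector `u_r(x) = ∫_{(0,∞)} e^{-rt} (P⁰_t J_B)(x) dt` of the CLOSED chain satisfies
`r ∫ u_r² dμ_T ≤ C (k₂ - k₁) Z` (on paper this is, by `⟨J_B, u_r⟩_{μ_T} = r‖u_r‖²`, the statement that the
Abel-regularised finite-volume Green–Kubo integral `∫_{(0,∞)} e^{-rt} ⟨J_B∘Φ_t, J_B⟩_{μ_T} dt` is `≤ C (k₂ - k₁) Z`,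
uniformly in `N`, block and cutoff). Then the crux E2 holds, with constant `max(C₁,0) + 9 max(C,0)` (`C₁` from `Partial.shortWindows`):
windows `τ ≤ 1` statically, and for `τ ≥ 1` the Abel window ceiling at rate `r = 1/τ`,
`V_B(τ) ≤ 3 (r²τ² + 2) ‖u_r‖² = 9 ‖u_r‖² ≤ 9 C ℓ Z τ`. No regularity of `u_r` is assumed or used. [folklore] -/
theorem subBallisticWindow_of_abelBound : (∀ ω₂ lam β γ : ℝ, 0 < ω₂ → 0 < lam → 0 < β → 0 < γ → ∀ T : ℝ, 0 < T → ∃ C : ℝ, ∀ (N k₁ k₂ : ℕ), k₁ ≤ k₂ → k₂ + 1 ≤ N → ∀ r : ℝ, 0 < r → r ≤ 1 → let P := pinnedChain ω₂ lam β γ; let P₀ := pinnedChain ω₂ lam β 0; let μT : Measure (PhaseSpace N) := volume.withDensity (fun x : PhaseSpace N => ENNReal.ofReal (Real.exp (-(P.hamiltonian N x) / T))); let JB : PhaseSpace N → ℝ := fun z => ∑ i : Fin N, (if k₁ ≤ i.val ∧ i.val < k₂ then P.bondCurrent N i z else 0); r * ∫ x, (∫ t in Set.Ioi (0 : ℝ),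 Real.exp (-r * t) * (∫ y, JB y ∂(P₀.transitionKernel N T T t.toNNReal x))) ^ 2 ∂μT ≤ C * ((k₂ : ℝ) - k₁) * ∫ x, Real.exp (-(P.hamiltonian N x) / T) ∂volume) → SubBallisticWindow := by
  intro hA ω₂ lam β γ hω hl hβ hγ T hT
  obtain ⟨C1, hC1⟩ := Partial.shortWindows ω₂ lam β γ hω hl.le hβ.le T hT
  obtain ⟨CA, hCA⟩ := hA ω₂ lam β γ hω hl hβ hγ T hT
  refine ⟨max C1 0 + 9 * max CA 0, fun N k₁ k₂ hk hkN τ hτ => ?_⟩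
  simp only
  set Z := ∫ y, Real.exp (-((pinnedChain ω₂ lam β γ).hamiltonian N y) / T) ∂volume with hZ
  have hZ0 : 0 ≤ Z := integral_nonneg fun _ => (Real.exp_pos _).le
  have hℓ0 : (0 : ℝ) ≤ (k₂ : ℝ) - k₁ := sub_nonneg.mpr (by exact_mod_cast hk)
  have hτ1' : 0 ≤ 1 + τ := by linarith
  have hW0 : 0 ≤ (1 + τ) * ((k₂ : ℝ) - k₁) * Z := by positivity
  have hC10 : 0 ≤ max C1 0 := le_max_right _ _
  have hCA0 : 0 ≤ max CA 0 := le_max_right _ _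
  rcases le_or_gt τ 1 with hτ1 | hτ1
  · -- short windows: the static envelope
    have h1 := hC1 N k₁ k₂ hk τ hτ hτ1
    simp only at h1
    refine h1.trans ?_
    calc C1 * (1 + τ) * ((k₂ : ℝ) - k₁) * Z = C1 * ((1 + τ) * ((k₂ : ℝ) - k₁) * Z) := by ring
      _ ≤ (max C1 0 + 9 * max CA 0) * ((1 + τ) * ((k₂ : ℝ) - k₁) * Z) :=
          mul_le_mul_of_nonneg_right (by linarith [le_max_left C1 0]) hW0
      _ = _ := by ring
  · -- long windows: the Abel corrector at rate `r = 1/τ`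
    have hτ0 : 0 < τ := by linarith
    have hr0 : 0 < 1 / τ := by positivity
    have hr1 : 1 / τ ≤ 1 := by rw [div_le_one hτ0]; exact hτ1.le
    have h1 := hCA N k₁ k₂ hk hkN (1 / τ) hr0 hr1
    simp only at h1
    -- Dirac dictionary on both sides
    have hdict := Partial.integral_window_kernel_eq hω hl.le hβ.le γ N k₁ k₂ T τ (gibbsWeight ω₂ lam β γ N T)
    simp only [blockCurrent] at hdict
    rw [show (volume.withDensity fun x : PhaseSpace N =>
        ENNReal.ofReal (Real.exp (-((pinnedChain ω₂ lam β γ).hamiltonian N x) / T))) =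
        gibbsWeight ω₂ lam β γ N T from rfl, hdict]
    rw [show (volume.withDensity fun x : PhaseSpace N =>
        ENNReal.ofReal (Real.exp (-((pinnedChain ω₂ lam β γ).hamiltonian N x) / T))) =
        gibbsWeight ω₂ lam β γ N T from rfl] at h1
    have hdictA : ∀ x : PhaseSpace N, (∫ t in Ioi (0:ℝ), Real.exp (-(1 / τ) * t) *
        (∫ y, blockCurrent ω₂ lam β γ N k₁ k₂ y ∂((pinnedChain ω₂ lam β 0).transitionKernel N T T t.toNNReal x))) =
        ∫ t in Ioi (0:ℝ), Real.exp (-(1 / τ) * t) * blockCurrent ω₂ lam β γ N k₁ k₂ (detFlow ω₂ lam β N t x) :=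
      fun x => integral_abel_kernel_eq hω hl.le hβ.le γ N k₁ k₂ T (1 / τ) x
    have hIeq : ∫ x, (∫ t in Ioi (0:ℝ), Real.exp (-(1 / τ) * t) *
        (∫ y, blockCurrent ω₂ lam β γ N k₁ k₂ y ∂((pinnedChain ω₂ lam β 0).transitionKernel N T T t.toNNReal x))) ^ 2
          ∂(gibbsWeight ω₂ lam β γ N T) =
        ∫ x, (∫ t in Ioi (0:ℝ), Real.exp (-(1 / τ) * t) *
          blockCurrent ω₂ lam β γ N k₁ k₂ (detFlow ω₂ lam β N t x)) ^ 2 ∂(gibbsWeight ω₂ lam β γ N T) :=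
      integral_congr_ae (Eventually.of_forall fun x => by simp only [hdictA x])
    simp only [blockCurrent] at hIeq
    rw [hIeq] at h1
    -- the Abel window ceiling
    have hceil := integral_window_sq_le_abel hω hl.le hβ.le γ N k₁ k₂ hT hr0 hτ
    simp only [window, blockCurrent] at hceil
    set I := ∫ x, (∫ t in Ioi (0:ℝ), Real.exp (-(1 / τ) * t) *
      ∑ i : Fin N, (if k₁ ≤ i.val ∧ i.val < k₂ then
        (pinnedChain ω₂ lam β γ).bondCurrent N i (detFlow ω₂ lam β N t x) else 0)) ^ 2
        ∂(gibbsWeight ω₂ lam β γ N T) with hI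
    have hI0 : 0 ≤ I := integral_nonneg fun _ => sq_nonneg _
    have hrτ : (1 / τ) ^ 2 * τ ^ 2 = 1 := by field_simp
    have hIle : I ≤ τ * (CA * ((k₂ : ℝ) - k₁) * Z) := by
      have h2 : τ * ((1 / τ) * I) ≤ τ * (CA * ((k₂ : ℝ) - k₁) * Z) := mul_le_mul_of_nonneg_left h1 hτ0.le
      have h3 : τ * ((1 / τ) * I) = I := by field_simp
      linarith
    refine hceil.trans ?_
    rw [hrτ]
    have hCAτ : τ * (CA * ((k₂ : ℝ) - k₁) * Z) ≤ max CA 0 * ((1 + τ) * ((k₂ : ℝ) - k₁) * Z) := by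
      have h4 : CA * ((k₂ : ℝ) - k₁) * Z ≤ max CA 0 * (((k₂ : ℝ) - k₁) * Z) := by
        rw [mul_assoc]
        exact mul_le_mul_of_nonneg_right (le_max_left _ _) (by positivity)
      have h5 : τ * (max CA 0 * (((k₂ : ℝ) - k₁) * Z)) ≤ (1 + τ) * (max CA 0 * (((k₂ : ℝ) - k₁) * Z)) :=
        mul_le_mul_of_nonneg_right (by linarith) (by positivity)
      nlinarith
    nlinarith

end Crux

end Summit.AtomisticToContinuum.FouriersLaw.Theorems.SubBallisticWindow.AbelGreenKubo

end
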